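import Mathlib.Analysis.Calculus.LineDeriv.IntegrationByParts
import Literature.Analysis.FluidPDE.Seregin2022LogSwirlCriterion
import Literature.Analysis.FluidPDE.AxisymVorticityAlgebra
import Literature.Analysis.FluidPDE.EnergyToolkit
import HarnessLib

/-!
# Seregin 2022, proof of Thm. 1.2 — proved steps (I): Lemma 2.2, the two-dimensional
# Leray (logarithmic Hardy) inequality `∫ f²/(|x'|² ln²(e/|x'|)) ≤ 4 ∫ |∇_{x'} f|²`

Analysis/FluidPDE proof file (theorems only; no definitions, no named facts, no `sorry`): the
sibling of `Seregin2022LogSwirlCriterion.lean`, on the discharge path of the named fact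
`Literature.Analysis.FluidPDE.seregin2022_logSwirl_regularAtOrigin` (G. Seregin, *A note on local
regularity of axisymmetric solutions to the Navier–Stokes equations*, J. Math. Fluid Mech. 24
(2022), Paper No. 27 = arXiv:2201.00153, Thm. 1.2 run from the swirl bound (2.2)).  The printed
proof (§2, Steps 1–4) is mirrored step by step; this file proves the first self-contained step,
the inequality that Step 3 applies to `η³Γ`, `η³Φ` and `∇_{x'}(η³v_r/r)`:

> **Lemma 2.2.** For any function `f ∈ C¹₀(𝒞)`, the following inequality is valid:
> `∫_𝒞 |f|²/(|x'|² ln²(e/|x'|)) dx ≤ 4 ∫_𝒞 |∇_{x'} f|² dx`.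
> "The proof can be done with the help of integration by parts."

(`𝒞 = {|x'| < 1, |x₃| < 1}`; this is Leray's two-dimensional inequality
`∫ |u|²/(|x|² log²|x|) ≤ 4 ∫ |∇u|²`, J. Math. Pures Appl. 12 (1933), integrated in `x₃`.)

## Statements

* `Seregin2022.integral_sq_div_cylRadius_log_sq_le` — the `ℝ³` form consumed by Step 3: for
  `f ∈ C¹(ℝ³)` with compact support and `f = 0` wherever `|x'| ≥ 1`, the function
  `f²/(|x'|² ln²(e/|x'|))` is integrable on `ℝ³` and
  `∫ f²/(|x'|² ln²(e/|x'|)) ≤ 4 ∫ ((∂₀f)² + (∂₁f)²)`, in the currency of the fact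
  (`cylRadius x = |x'|`, `Real.log (Real.exp 1 / cylRadius x) = ln(e/|x'|)`, junk value `0` on the
  axis, where the integrand is `f²/0 = 0` — a null set);
* `Seregin2022.lemma22` — the printed form: `f ∈ C¹` compactly supported in `𝒞 = spaceCyl 0 1`,
  set integrals over `𝒞`;
* `Seregin2022.integral_sq_mul_regWeight_le` — the regularised inequality it rests on: for
  `0 < δ ≤ 1`, `∫ f² W_δ ≤ 4 ∫ |∇_{x'}f|²` with `W_δ = ((ρ + δ)(1 − ½ log(ρ + δ))²)⁻¹`,
  `ρ = x₀² + x₁² = |x'|²` (so that `W_0 = (|x'|² ln²(e/|x'|))⁻¹`).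
* `Seregin2022.integral_mul_fderiv_apply_eq_zero_of_divFree_near` — first input of the energy
  identities of Step 3: the transport term `∫ f Df[b]` vanishes for `f ∈ C¹_c` and a drift `b`
  that is `C¹` and divergence free only on a neighbourhood of `tsupport f` (local twin of the
  tree's `integral_mul_fderiv_apply_eq_zero_of_isDivFree`).

## Proof (the printed integration by parts, made rigorous at the axis)

In the plane, `(|x'|² L²)⁻¹ = div_{x'} (x'/(|x'|² L))` with `L = ln(e/|x'|) = 1 − ½ log ρ`, so
for `f ∈ C¹_c` one has `∫ f²/(|x'|²L²) = −2 ∫ f ∇_{x'}f · x'/(|x'|²L) ≤ 2 (∫ f²/(|x'|²L²))^{1/2}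
(∫ |∇_{x'}f|²)^{1/2}`, whence the claim with the constant `4`.  The field `x'/(|x'|² L)` is
singular on the axis, so the integration by parts is run for the REGULARISED field
`V_δ = x' k_δ`, `k_δ = ((ρ + δ)(1 − ½ log(ρ + δ)))⁻¹`, `0 < δ ≤ 1`, which is `C¹` near the support
of `f` (there `ρ ≤ 1`, `ρ + δ ≤ 2`, `M := 1 − ½ log(ρ + δ) ≥ ½`): with `s = ρ + δ`,
`div_{x'} V_δ = 2k_δ + 2ρ k_δ'(ρ) = (ρ + 2δM)/(s²M²) ≥ (sM²)⁻¹ = W_δ` (as `2M ≥ 1`) and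
`ρ k_δ² = ρ/(s²M²) ≤ W_δ` (as `ρ ≤ s`), so Mathlib's whole-space integration by parts
(`integral_mul_fderiv_eq_neg_fderiv_mul_of_integrable`, differentiability being needed only on
`tsupport f²`) and Cauchy–Schwarz give `∫ f² W_δ ≤ 2 (∫ f² W_δ)^{1/2} (∫|∇_{x'}f|²)^{1/2}`, i.e.
`∫ f² W_δ ≤ 4 ∫ |∇_{x'}f|²` for every `δ` (`integral_sq_mul_regWeight_le`).  As `δ → 0⁺`,
`W_δ → (|x'|² ln²(e/|x'|))⁻¹` off the axis, and Fatou's lemma (`lintegral_liminf_le` along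
`δ = 1/(n+1)`) yields the integrability of `f²/(|x'|² ln²(e/|x'|))` together with the inequality.
Deviation from the printed one-line proof: only the regularisation `δ > 0` (the paper integrates by
parts directly); the one-dimensional cores of the tree (`Calculus.hardy_log_core`,
`FluidPDE.logHardy`, radial variable) are not used, which avoids cylindrical coordinates.

## Mathlib / tree search

Tree: `cylRadius`, `cylRadius_sq`, `continuous_cylRadius` (`AxisymmetricEuler`),
`hasFDerivAt_horizSq`, `contDiff_horizSq` (`AxisymVorticityAlgebra`),
`integral_mul_le_sqrt_mul_sqrt_of_memLp` (`EnergyToolkit`), `SereginSverak2009.spaceCyl`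
(`SereginSverakAxisymmetric`); 1D log-Hardy inequalities `Calculus.hardy_log_core`
(`HardyLogarithmic`), `logHardy` (`LeiZhang2017LogHardy`) — same weight in the radial variable, not
used.  Mathlib: `integral_mul_fderiv_eq_neg_fderiv_mul_of_integrable`, `lintegral_liminf_le`,
`hasFiniteIntegral_iff_ofReal`, `Continuous.memLp_of_hasCompactSupport`,
`memLp_two_iff_integrable_sq`.  `lean search 'cylRadius_log|lemma22|regWeight'`: nothing before
this file.

## References

* G. Seregin, J. Math. Fluid Mech. 24 (2022), Paper No. 27 = arXiv:2201.00153, §2, Step 3,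
  Lemma 2.2. [`Seregin2022LocalAxisym`]
* J. Leray, *Étude de diverses équations intégrales non linéaires et de quelques problèmes que pose
  l'hydrodynamique*, J. Math. Pures Appl. 12 (1933), 1–82 (the inequality in dimension two).
  [folklore]
-/

noncomputable section

open MeasureTheory Set Function Filter Topology
open scoped ENNReal NNReal

namespace Literature.Analysis.FluidPDE

namespace Seregin2022

/-! ### The one-variable profile `k(s) = (s (1 − ½ log s))⁻¹` -/

/-- `d/ds [s (1 − ½ log s)] = (1 − ½ log s) − ½` for `s > 0`. [folklore] -/
theorem hasDerivAt_mul_logFactor {s : ℝ} (hs : 0 < s) :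
    HasDerivAt (fun s : ℝ => s * (1 - Real.log s / 2)) (1 - Real.log s / 2 - 1 / 2) s := by
  have h1 : HasDerivAt (fun s : ℝ => 1 - Real.log s / 2) (0 - s⁻¹ / 2) s :=
    (hasDerivAt_const s (1 : ℝ)).sub ((Real.hasDerivAt_log hs.ne').div_const 2)
  have h := (hasDerivAt_id' s).fun_mul h1
  refine h.congr_deriv ?_
  field_simp
  ring

/-- `d/ds (s (1 − ½ log s))⁻¹ = −(2M − 1)/(2 s² M²)`, `M = 1 − ½ log s`, for `s > 0`, `M ≠ 0`.
[folklore] -/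
theorem hasDerivAt_profile {s : ℝ} (hs : 0 < s) (hM : 1 - Real.log s / 2 ≠ 0) :
    HasDerivAt (fun s : ℝ => (s * (1 - Real.log s / 2))⁻¹)
      (-(2 * (1 - Real.log s / 2) - 1) / (2 * s ^ 2 * (1 - Real.log s / 2) ^ 2)) s := by
  have hne : s * (1 - Real.log s / 2) ≠ 0 := mul_ne_zero hs.ne' hM
  refine ((hasDerivAt_mul_logFactor hs).inv hne).congr_deriv ?_
  field_simp

/-! ### The regularised weight `k_δ = ((ρ + δ)(1 − ½ log(ρ + δ)))⁻¹`, `ρ = x₀² + x₁²` -/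

/-- `D(ρ + δ)(x) h = 2 (x₀h₀ + x₁h₁)`. [folklore] -/
theorem hasFDerivAt_horizSq_add (δ : ℝ) (x : EuclideanSpace ℝ (Fin 3)) :
    HasFDerivAt (fun y : EuclideanSpace ℝ (Fin 3) => y 0 ^ 2 + y 1 ^ 2 + δ)
      ((2 * x 0) • (EuclideanSpace.proj (0 : Fin 3) : EuclideanSpace ℝ (Fin 3) →L[ℝ] ℝ) +
        (2 * x 1) • (EuclideanSpace.proj (1 : Fin 3) : EuclideanSpace ℝ (Fin 3) →L[ℝ] ℝ)) x :=
  (hasFDerivAt_horizSq x).add_const δ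

/-- `ρ + δ` is continuous. [folklore] -/
theorem continuous_horizSq_add (δ : ℝ) :
    Continuous fun y : EuclideanSpace ℝ (Fin 3) => y 0 ^ 2 + y 1 ^ 2 + δ :=
  (contDiff_horizSq (n := 0)).continuous.add continuous_const

/-- `ρ + δ > 0` for `δ > 0`. [folklore] -/
theorem horizSq_add_pos {δ : ℝ} (hδ : 0 < δ) (x : EuclideanSpace ℝ (Fin 3)) :
    0 < x 0 ^ 2 + x 1 ^ 2 + δ := by
  positivity

/-- Chain rule: the derivative of `k_δ(x) = ((ρ + δ)(1 − ½ log(ρ + δ)))⁻¹` at a point where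
`M = 1 − ½ log(ρ + δ) ≠ 0` is `−(2M − 1)/(2 s² M²) · D(ρ + δ)`, `s = ρ + δ`. [folklore] -/
theorem hasFDerivAt_regWeight {δ : ℝ} (hδ : 0 < δ) {x : EuclideanSpace ℝ (Fin 3)}
    (hM : 1 - Real.log (x 0 ^ 2 + x 1 ^ 2 + δ) / 2 ≠ 0) :
    HasFDerivAt (fun y : EuclideanSpace ℝ (Fin 3) =>
      ((y 0 ^ 2 + y 1 ^ 2 + δ) * (1 - Real.log (y 0 ^ 2 + y 1 ^ 2 + δ) / 2))⁻¹)
      ((-(2 * (1 - Real.log (x 0 ^ 2 + x 1 ^ 2 + δ) / 2) - 1) /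
          (2 * (x 0 ^ 2 + x 1 ^ 2 + δ) ^ 2 * (1 - Real.log (x 0 ^ 2 + x 1 ^ 2 + δ) / 2) ^ 2)) •
        ((2 * x 0) • (EuclideanSpace.proj (0 : Fin 3) : EuclideanSpace ℝ (Fin 3) →L[ℝ] ℝ) +
          (2 * x 1) • (EuclideanSpace.proj (1 : Fin 3) : EuclideanSpace ℝ (Fin 3) →L[ℝ] ℝ))) x :=
  by
  have h := HasDerivAt.comp_hasFDerivAt x (hasDerivAt_profile (horizSq_add_pos hδ x) hM)
    (hasFDerivAt_horizSq_add δ x)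
  exact h

/-- The coordinate function `x ↦ xᵢ` has derivative the `i`-th projection. [folklore] -/
theorem hasFDerivAt_coord (i : Fin 3) (x : EuclideanSpace ℝ (Fin 3)) :
    HasFDerivAt (fun y : EuclideanSpace ℝ (Fin 3) => y i)
      (EuclideanSpace.proj (𝕜 := ℝ) i : EuclideanSpace ℝ (Fin 3) →L[ℝ] ℝ) x := by
  convert (EuclideanSpace.proj (𝕜 := ℝ) i : EuclideanSpace ℝ (Fin 3) →L[ℝ] ℝ).hasFDerivAt
    using 1
  funext y
  simp [EuclideanSpace.proj]

/-- The horizontal field `V_δ = x' k_δ`: for `i = 0, 1`, `xᵢ k_δ` is differentiable at every point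
with `M ≠ 0` and `∂ᵢ(xᵢ k_δ) = k_δ + 2xᵢ² k_δ'(ρ)` there (`k_δ'(ρ) = −(2M − 1)/(2s²M²)`), so that
`div_{x'} V_δ = 2k_δ + 2ρ k_δ'(ρ)`. [folklore] -/
theorem fderiv_coord_mul_regWeight {δ : ℝ} (hδ : 0 < δ) {x : EuclideanSpace ℝ (Fin 3)}
    (hM : 1 - Real.log (x 0 ^ 2 + x 1 ^ 2 + δ) / 2 ≠ 0) {i : Fin 3} (hi : i = 0 ∨ i = 1) :
    DifferentiableAt ℝ (fun y : EuclideanSpace ℝ (Fin 3) => y i *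
      ((y 0 ^ 2 + y 1 ^ 2 + δ) * (1 - Real.log (y 0 ^ 2 + y 1 ^ 2 + δ) / 2))⁻¹) x ∧
    fderiv ℝ (fun y : EuclideanSpace ℝ (Fin 3) => y i *
      ((y 0 ^ 2 + y 1 ^ 2 + δ) * (1 - Real.log (y 0 ^ 2 + y 1 ^ 2 + δ) / 2))⁻¹) x
        (EuclideanSpace.single i (1 : ℝ)) =
      ((x 0 ^ 2 + x 1 ^ 2 + δ) * (1 - Real.log (x 0 ^ 2 + x 1 ^ 2 + δ) / 2))⁻¹ +
        2 * x i ^ 2 * (-(2 * (1 - Real.log (x 0 ^ 2 + x 1 ^ 2 + δ) / 2) - 1) /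
          (2 * (x 0 ^ 2 + x 1 ^ 2 + δ) ^ 2 * (1 - Real.log (x 0 ^ 2 + x 1 ^ 2 + δ) / 2) ^ 2)) := by
  have hw := (hasFDerivAt_coord i x).fun_mul (hasFDerivAt_regWeight hδ hM)
  refine ⟨hw.differentiableAt, ?_⟩
  rw [hw.fderiv]
  rcases hi with rfl | rfl <;>
    simp [EuclideanSpace.proj] <;> ring

/-! ### Support bookkeeping -/

variable {f : EuclideanSpace ℝ (Fin 3) → ℝ}

/-- If `f = 0` wherever `|x'| ≥ 1`, then `ρ = |x'|² ≤ 1` on `tsupport f`. [folklore] -/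
theorem horizSq_le_one_of_mem_tsupport (hf1 : ∀ x, 1 ≤ cylRadius x → f x = 0)
    {x : EuclideanSpace ℝ (Fin 3)} (hx : x ∈ tsupport f) : x 0 ^ 2 + x 1 ^ 2 ≤ 1 := by
  have hsub : support f ⊆ {y : EuclideanSpace ℝ (Fin 3) | y 0 ^ 2 + y 1 ^ 2 ≤ 1} := by
    intro y hy
    have hlt : cylRadius y < 1 := lt_of_not_ge fun h => hy (hf1 y h)
    have h0 := cylRadius_nonneg y
    have : cylRadius y ^ 2 ≤ 1 := by nlinarith
    simpa [cylRadius_sq] using this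
  have hcl : IsClosed {y : EuclideanSpace ℝ (Fin 3) | y 0 ^ 2 + y 1 ^ 2 ≤ 1} :=
    isClosed_le (contDiff_horizSq (n := 0)).continuous continuous_const
  exact closure_minimal hsub hcl hx

/-- For `0 ≤ ρ ≤ 1` and `0 < δ ≤ 1`: `M = 1 − ½ log(ρ + δ) ≥ ½` (`log 2 ≤ 1`). [folklore] -/
theorem half_le_logFactor {ρ δ : ℝ} (hρ : 0 ≤ ρ) (hρ1 : ρ ≤ 1) (hδ : 0 < δ) (hδ1 : δ ≤ 1) :
    1 / 2 ≤ 1 - Real.log (ρ + δ) / 2 := by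
  have hs : 0 < ρ + δ := by linarith
  have h2 : Real.log (ρ + δ) ≤ Real.log 2 := Real.log_le_log hs (by linarith)
  have h3 : Real.log 2 ≤ 1 := by
    have := Real.log_le_sub_one_of_pos (show (0 : ℝ) < 2 by norm_num)
    linarith
  linarith

/-- A function continuous on the compact set `tsupport f` and vanishing off it is integrable.
[folklore] -/
theorem integrable_of_continuousOn_tsupport (hfc : HasCompactSupport f)
    {F : EuclideanSpace ℝ (Fin 3) → ℝ}
    (hF : ContinuousOn F (tsupport f)) (hs : support F ⊆ tsupport f) : Integrable F :=
  (integrableOn_iff_integrable_of_support_subset hs).mp (hF.integrableOn_compact hfc)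


/-! ### The regularised inequality `∫ f² W_δ ≤ 4 ∫ |∇_{x'} f|²` -/

/-- `∂ᵥ(f²) = 2 f ∂ᵥf`. [folklore] -/
theorem fderiv_sq_apply (hf : Differentiable ℝ f) (x v : EuclideanSpace ℝ (Fin 3)) :
    fderiv ℝ (fun y => f y ^ 2) x v = 2 * f x * fderiv ℝ f x v := by
  have h := (hf x).hasFDerivAt.fun_mul (hf x).hasFDerivAt
  have h2 : (fun y => f y ^ 2) = fun y => f y * f y := funext fun y => sq (f y)
  rw [h2, h.fderiv]
  simp only [add_apply, smul_apply, smul_eq_mul]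
  ring

/-- Cauchy–Schwarz in the plane: `|a p + b q| ≤ √(a² + b²) √(p² + q²)`. [folklore] -/
theorem abs_horiz_pairing_le (a b p q : ℝ) :
    |a * p + b * q| ≤ Real.sqrt (a ^ 2 + b ^ 2) * Real.sqrt (p ^ 2 + q ^ 2) := by
  rw [← Real.sqrt_mul (by positivity)]
  refine Real.abs_le_sqrt ?_
  nlinarith [sq_nonneg (a * q - b * p)]

/-- **The regularised Leray inequality** (Seregin 2022, Lemma 2.2, proof: integration by parts
against the field `x'/(|x'|² ln(e/|x'|))`, here regularised).  For `f ∈ C¹(ℝ³)` with compact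
support, `f = 0` wherever `|x'| ≥ 1`, and `0 < δ ≤ 1`: with `ρ = x₀² + x₁²`,
`W_δ = ((ρ + δ)(1 − ½ log(ρ + δ))²)⁻¹`, the function `f² W_δ` is integrable and
`∫ f² W_δ ≤ 4 ∫ ((∂₀f)² + (∂₁f)²)`.  (`div_{x'}(x' k_δ) ≥ W_δ ≥ ρ k_δ²` near `tsupport f`,
whole-space integration by parts, Cauchy–Schwarz; module docstring.)
[cite: Seregin2022LocalAxisym, §2 Step 3, Lemma 2.2 (proof)] -/
theorem integral_sq_mul_regWeight_le (hf : ContDiff ℝ 1 f) (hfc : HasCompactSupport f)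
    (hf1 : ∀ x, 1 ≤ cylRadius x → f x = 0) {δ : ℝ} (hδ : 0 < δ) (hδ1 : δ ≤ 1) :
    Integrable (fun x => f x ^ 2 *
      ((x 0 ^ 2 + x 1 ^ 2 + δ) * (1 - Real.log (x 0 ^ 2 + x 1 ^ 2 + δ) / 2) ^ 2)⁻¹) ∧
    ∫ x, f x ^ 2 * ((x 0 ^ 2 + x 1 ^ 2 + δ) * (1 - Real.log (x 0 ^ 2 + x 1 ^ 2 + δ) / 2) ^ 2)⁻¹ ≤
      4 * ∫ x, (fderiv ℝ f x (EuclideanSpace.single 0 1) ^ 2 +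
        fderiv ℝ f x (EuclideanSpace.single 1 1) ^ 2) := by
  set e : Fin 3 → EuclideanSpace ℝ (Fin 3) := fun i => EuclideanSpace.single i 1 with he
  have he' : ∀ i, EuclideanSpace.single i (1 : ℝ) = e i := fun i => rfl
  simp only [he']
  -- the players
  obtain ⟨S, hS⟩ : ∃ S : EuclideanSpace ℝ (Fin 3) → ℝ, ∀ x, S x = x 0 ^ 2 + x 1 ^ 2 + δ :=
    ⟨_, fun x => rfl⟩
  obtain ⟨M, hM⟩ : ∃ M : EuclideanSpace ℝ (Fin 3) → ℝ, ∀ x, M x = 1 - Real.log (S x) / 2 :=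
    ⟨_, fun x => rfl⟩
  obtain ⟨k, hk⟩ : ∃ k : EuclideanSpace ℝ (Fin 3) → ℝ, ∀ x, k x = (S x * M x)⁻¹ :=
    ⟨_, fun x => rfl⟩
  obtain ⟨φ', hφ'⟩ : ∃ φ' : EuclideanSpace ℝ (Fin 3) → ℝ, ∀ x,
      φ' x = -(2 * M x - 1) / (2 * S x ^ 2 * M x ^ 2) :=
    ⟨_, fun x => rfl⟩
  obtain ⟨W, hW⟩ : ∃ W : EuclideanSpace ℝ (Fin 3) → ℝ, ∀ x, W x = (S x * M x ^ 2)⁻¹ :=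
    ⟨_, fun x => rfl⟩
  obtain ⟨D, hD⟩ : ∃ D : EuclideanSpace ℝ (Fin 3) → ℝ, ∀ x,
      D x = (x 0 ^ 2 + x 1 ^ 2 + 2 * δ * M x) / (S x ^ 2 * M x ^ 2) := ⟨_, fun x => rfl⟩
  obtain ⟨P, hP⟩ : ∃ P : EuclideanSpace ℝ (Fin 3) → ℝ, ∀ x,
      P x = x 0 * fderiv ℝ f x (e 0) + x 1 * fderiv ℝ f x (e 1) := ⟨_, fun x => rfl⟩
  obtain ⟨N, hN⟩ : ∃ N : EuclideanSpace ℝ (Fin 3) → ℝ, ∀ x,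
      N x = Real.sqrt (fderiv ℝ f x (e 0) ^ 2 + fderiv ℝ f x (e 1) ^ 2) := ⟨_, fun x => rfl⟩
  -- basic facts on `f`
  have hfd : Differentiable ℝ f := hf.differentiable one_ne_zero
  have cf : Continuous f := hf.continuous
  have cDf : ∀ v, Continuous fun x => fderiv ℝ f x v := fun v =>
    (hf.continuous_fderiv one_ne_zero).clm_apply continuous_const
  have hK : IsCompact (tsupport f) := hfc
  have hfK : ∀ x, x ∉ tsupport f → f x = 0 := fun x hx => image_eq_zero_of_notMem_tsupport hx
  have hDfK : ∀ x, x ∉ tsupport f → ∀ v, fderiv ℝ f x v = 0 := by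
    intro x hx v
    have h0 : fderiv ℝ f x = 0 := by
      by_contra h
      exact hx (support_fderiv_subset ℝ (Function.mem_support.2 h))
    rw [h0]; rfl
  have hDg : ∀ x v, fderiv ℝ (fun y => f y ^ 2) x v = 2 * f x * fderiv ℝ f x v :=
    fderiv_sq_apply hfd
  have hgd : Differentiable ℝ fun y => f y ^ 2 := hfd.pow 2
  -- basic facts on the weights
  have hSpos : ∀ x, 0 < S x := fun x => by rw [hS]; positivity
  have hScont : Continuous S := by
    rw [show S = fun x => x 0 ^ 2 + x 1 ^ 2 + δ from funext hS]
    exact continuous_horizSq_add δ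
  have hW0 : ∀ x, 0 ≤ W x := fun x => by rw [hW]; have := hSpos x; positivity
  have hρK : ∀ x ∈ tsupport f, x 0 ^ 2 + x 1 ^ 2 ≤ 1 := fun x hx =>
    horizSq_le_one_of_mem_tsupport hf1 hx
  have hMK : ∀ x ∈ tsupport f, 1 / 2 ≤ M x := fun x hx => by
    rw [hM, hS]
    exact half_le_logFactor (by positivity) (hρK x hx) hδ hδ1
  have hMpos : ∀ x ∈ tsupport f, 0 < M x := fun x hx => by linarith [hMK x hx]
  have hMne : ∀ x ∈ tsupport f, M x ≠ 0 := fun x hx => (hMpos x hx).ne'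
  have hMexpl : ∀ x, M x = 1 - Real.log (x 0 ^ 2 + x 1 ^ 2 + δ) / 2 := fun x => by rw [hM, hS]
  -- derivative of the field `x_i k` on `K`
  have hderiv : ∀ {i : Fin 3}, i = 0 ∨ i = 1 → ∀ x ∈ tsupport f,
      DifferentiableAt ℝ (fun y : EuclideanSpace ℝ (Fin 3) => y i * k y) x ∧
      fderiv ℝ (fun y : EuclideanSpace ℝ (Fin 3) => y i * k y) x (e i) =
        k x + 2 * x i ^ 2 * φ' x := by
    intro i hi x hx
    have hM' : 1 - Real.log (x 0 ^ 2 + x 1 ^ 2 + δ) / 2 ≠ 0 := by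
      rw [← hMexpl]; exact hMne x hx
    obtain ⟨h1, h2⟩ := fderiv_coord_mul_regWeight hδ hM' hi
    have hkfun : (fun y : EuclideanSpace ℝ (Fin 3) => y i * k y) = fun y => y i *
        ((y 0 ^ 2 + y 1 ^ 2 + δ) * (1 - Real.log (y 0 ^ 2 + y 1 ^ 2 + δ) / 2))⁻¹ :=
      funext fun y => by rw [hk, hM, hS]
    rw [hkfun]
    refine ⟨h1, ?_⟩
    rw [he'] at h2
    rw [h2, hk, hφ', hM, hS]
  -- continuity at points of `K`
  have hMc : ∀ x ∈ tsupport f, ContinuousAt M x := fun x _ => by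
    rw [show M = fun y => 1 - Real.log (S y) / 2 from funext hM]
    exact continuousAt_const.sub (((hScont.continuousAt).log (hSpos x).ne').div_const 2)
  have hkc : ∀ x ∈ tsupport f, ContinuousAt k x := fun x hx => by
    rw [show k = fun y => (S y * M y)⁻¹ from funext hk]
    exact (hScont.continuousAt.mul (hMc x hx)).inv₀ (mul_ne_zero (hSpos x).ne' (hMne x hx))
  have hφc : ∀ x ∈ tsupport f, ContinuousAt φ' x := fun x hx => by
    rw [show φ' = fun y => -(2 * M y - 1) / (2 * S y ^ 2 * M y ^ 2) from funext hφ']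
    refine ((continuousAt_const.mul (hMc x hx)).sub continuousAt_const).neg.div
      ((continuousAt_const.mul (hScont.continuousAt.pow 2)).mul ((hMc x hx).pow 2)) ?_
    exact mul_ne_zero (mul_ne_zero two_ne_zero (pow_ne_zero _ (hSpos x).ne'))
      (pow_ne_zero _ (hMne x hx))
  have hWc : ∀ x ∈ tsupport f, ContinuousAt W x := fun x hx => by
    rw [show W = fun y => (S y * M y ^ 2)⁻¹ from funext hW]
    exact (hScont.continuousAt.mul ((hMc x hx).pow 2)).inv₀
      (mul_ne_zero (hSpos x).ne' (pow_ne_zero _ (hMne x hx)))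
  have hDc : ∀ x ∈ tsupport f, ContinuousAt D x := fun x hx => by
    rw [show D = fun y => (y 0 ^ 2 + y 1 ^ 2 + 2 * δ * M y) / (S y ^ 2 * M y ^ 2) from funext hD]
    refine ((contDiff_horizSq (n := 0)).continuous.continuousAt.add
      (continuousAt_const.mul (hMc x hx))).div
      ((hScont.continuousAt.pow 2).mul ((hMc x hx).pow 2)) ?_
    exact mul_ne_zero (pow_ne_zero _ (hSpos x).ne') (pow_ne_zero _ (hMne x hx))
  have cx : ∀ i : Fin 3, Continuous fun x : EuclideanSpace ℝ (Fin 3) => x i := fun i =>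
    (contDiff_piLp_apply (𝕜 := ℝ) (p := 2) (n := 0) (i := i)).continuous
  -- integrability of everything in sight
  have hInt : ∀ {F : EuclideanSpace ℝ (Fin 3) → ℝ}, (∀ x ∈ tsupport f, ContinuousAt F x) →
      (∀ x, x ∉ tsupport f → F x = 0) → Integrable F := fun hF h0 =>
    integrable_of_continuousOn_tsupport hfc (fun x hx => (hF x hx).continuousWithinAt)
      (support_subset_iff'.2 h0)
  have iX : Integrable fun x => f x ^ 2 * W x :=
    hInt (fun x hx => ((cf.pow 2).continuousAt).mul (hWc x hx)) (fun x hx => by simp [hfK x hx])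
  have iD : Integrable fun x => D x * f x ^ 2 :=
    hInt (fun x hx => (hDc x hx).mul ((cf.pow 2).continuousAt)) (fun x hx => by simp [hfK x hx])
  have iP : Integrable fun x => f x * k x * P x := by
    refine hInt (fun x hx => (cf.continuousAt.mul (hkc x hx)).mul ?_)
      (fun x hx => by simp [hfK x hx])
    rw [show P = fun y => y 0 * fderiv ℝ f y (e 0) + y 1 * fderiv ℝ f y (e 1) from funext hP]
    exact (((cx 0).mul (cDf _)).add ((cx 1).mul (cDf _))).continuousAt
  -- integration by parts, `i = 0, 1`
  have ibp : ∀ {i : Fin 3}, i = 0 ∨ i = 1 →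
      ∫ x, (x i * k x) * (2 * f x * fderiv ℝ f x (e i)) =
        -∫ x, (k x + 2 * x i ^ 2 * φ' x) * f x ^ 2 := by
    intro i hi
    have hcxk : ∀ x ∈ tsupport f, ContinuousAt (fun y : EuclideanSpace ℝ (Fin 3) => y i * k y) x :=
      fun x hx =>
      (cx i).continuousAt.mul (hkc x hx)
    have i1 : Integrable fun x =>
        fderiv ℝ (fun y : EuclideanSpace ℝ (Fin 3) => y i * k y) x (e i) * f x ^ 2 := by
      have i1' : Integrable fun x => (k x + 2 * x i ^ 2 * φ' x) * f x ^ 2 :=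
        hInt (fun x hx => ((hkc x hx).add ((continuousAt_const.mul ((cx i).continuousAt.pow 2)).mul
          (hφc x hx))).mul ((cf.pow 2).continuousAt)) (fun x hx => by simp [hfK x hx])
      refine i1'.congr (ae_of_all _ fun x => ?_)
      beta_reduce
      by_cases hx : x ∈ tsupport f
      · rw [(hderiv hi x hx).2]
      · simp [hfK x hx]
    have i2 : Integrable fun x => (x i * k x) * fderiv ℝ (fun y => f y ^ 2) x (e i) := by
      have i2' : Integrable fun x => (x i * k x) * (2 * f x * fderiv ℝ f x (e i)) :=
        hInt (fun x hx => (hcxk x hx).mul ((continuous_const.mul cf).mul (cDf _)).continuousAt)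
          (fun x hx => by simp [hfK x hx])
      exact i2'.congr (ae_of_all _ fun x => by beta_reduce; rw [hDg])
    have i3 : Integrable fun x => (x i * k x) * f x ^ 2 :=
      hInt (fun x hx => (hcxk x hx).mul ((cf.pow 2).continuousAt)) (fun x hx => by simp [hfK x hx])
    have hdiff : ∀ x ∈ tsupport (fun y => f y ^ 2),
        DifferentiableAt ℝ (fun y : EuclideanSpace ℝ (Fin 3) => y i * k y) x := by
      intro x hx
      have hsub : support (fun y => f y ^ 2) ⊆ support f := fun y hy => by
        rw [Function.mem_support] at hy ⊢
        exact fun h => hy (by simp [h])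
      have hx' : x ∈ tsupport f := closure_mono hsub hx
      exact (hderiv hi x hx').1
    have h := integral_mul_fderiv_eq_neg_fderiv_mul_of_integrable (μ := volume)
      (f := fun y : EuclideanSpace ℝ (Fin 3) => y i * k y) (g := fun y => f y ^ 2) (v := e i)
      i1 i2 i3 hdiff
      (fun x _ => hgd x)
    rw [show (fun x => (x i * k x) * (2 * f x * fderiv ℝ f x (e i))) =
        fun x => (x i * k x) * fderiv ℝ (fun y => f y ^ 2) x (e i) from
      funext fun x => by rw [hDg]]
    rw [h]
    congr 1
    refine integral_congr_ae (ae_of_all _ fun x => ?_)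
    beta_reduce
    by_cases hx : x ∈ tsupport f
    · rw [(hderiv hi x hx).2]
    · simp [hfK x hx]
  -- the identity `∫ D f² = -2 ∫ f k P`
  have hstar : ∫ x, D x * f x ^ 2 = -2 * ∫ x, f x * k x * P x := by
    have e0 := ibp (i := 0) (Or.inl rfl)
    have e1 := ibp (i := 1) (Or.inr rfl)
    have iL : ∀ {i : Fin 3}, i = 0 ∨ i = 1 →
        Integrable fun x => (x i * k x) * (2 * f x * fderiv ℝ f x (e i)) := fun {i} hi =>
      hInt (fun x hx => ((cx i).continuousAt.mul (hkc x hx)).mul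
        ((continuous_const.mul cf).mul (cDf _)).continuousAt) (fun x hx => by simp [hfK x hx])
    have iR : ∀ {i : Fin 3}, i = 0 ∨ i = 1 →
        Integrable fun x => (k x + 2 * x i ^ 2 * φ' x) * f x ^ 2 := fun {i} hi =>
      hInt (fun x hx => ((hkc x hx).add ((continuousAt_const.mul ((cx i).continuousAt.pow 2)).mul
        (hφc x hx))).mul ((cf.pow 2).continuousAt)) (fun x hx => by simp [hfK x hx])
    have hL : (∫ x, (x 0 * k x) * (2 * f x * fderiv ℝ f x (e 0))) +
        ∫ x, (x 1 * k x) * (2 * f x * fderiv ℝ f x (e 1)) = 2 * ∫ x, f x * k x * P x := by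
      rw [← integral_add (iL (Or.inl rfl)) (iL (Or.inr rfl)), ← integral_const_mul]
      refine integral_congr_ae (ae_of_all _ fun x => ?_)
      simp only [hP]
      ring
    have hR : (∫ x, (k x + 2 * x 0 ^ 2 * φ' x) * f x ^ 2) +
        ∫ x, (k x + 2 * x 1 ^ 2 * φ' x) * f x ^ 2 = ∫ x, D x * f x ^ 2 := by
      rw [← integral_add (iR (Or.inl rfl)) (iR (Or.inr rfl))]
      refine integral_congr_ae (ae_of_all _ fun x => ?_)
      by_cases hx : x ∈ tsupport f
      · have hS0 : S x ≠ 0 := (hSpos x).ne'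
        have hM0 : M x ≠ 0 := hMne x hx
        simp only [hk, hφ', hD]
        rw [hS] at hS0 ⊢
        field_simp
        ring
      · simp [hfK x hx]
    linarith
  -- `X ≤ ∫ D f²`
  set X : ℝ := ∫ x, f x ^ 2 * W x with hX
  set B : ℝ := ∫ x, (fderiv ℝ f x (e 0) ^ 2 + fderiv ℝ f x (e 1) ^ 2) with hB
  have hB0 : 0 ≤ B := integral_nonneg fun x => by positivity
  have hX0 : 0 ≤ X := integral_nonneg fun x => mul_nonneg (sq_nonneg _) (hW0 x)
  have h1 : X ≤ ∫ x, D x * f x ^ 2 := by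
    refine integral_mono iX iD fun x => ?_
    by_cases hx : x ∈ tsupport f
    · have hWD : W x ≤ D x := by
        have hS0 : 0 < S x := hSpos x
        have hM0 : 0 < M x := hMpos x hx
        have hle : S x ≤ x 0 ^ 2 + x 1 ^ 2 + 2 * δ * M x := by
          rw [hS]; nlinarith [hMK x hx]
        rw [hW, hD, inv_eq_one_div, div_le_div_iff₀ (by positivity) (by positivity)]
        calc 1 * (S x ^ 2 * M x ^ 2) = S x * (S x * M x ^ 2) := by ring
          _ ≤ (x 0 ^ 2 + x 1 ^ 2 + 2 * δ * M x) * (S x * M x ^ 2) :=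
            mul_le_mul_of_nonneg_right hle (by positivity)
      simp only
      rw [mul_comm (D x)]
      exact mul_le_mul_of_nonneg_left hWD (sq_nonneg _)
    · simp [hfK x hx]
  -- `∫ D f² ≤ 2 √X √B`
  have hkW : ∀ x ∈ tsupport f, |k x| * Real.sqrt (x 0 ^ 2 + x 1 ^ 2) ≤ Real.sqrt (W x) := by
    intro x hx
    rw [← Real.sqrt_sq_eq_abs, ← Real.sqrt_mul (sq_nonneg _)]
    refine Real.sqrt_le_sqrt ?_
    have hS0 : 0 < S x := hSpos x
    have hM0 : 0 < M x := hMpos x hx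
    have hρS : x 0 ^ 2 + x 1 ^ 2 ≤ S x := by rw [hS]; linarith
    have hkx : k x ^ 2 * (x 0 ^ 2 + x 1 ^ 2) = (x 0 ^ 2 + x 1 ^ 2) / (S x ^ 2 * M x ^ 2) := by
      rw [hk]; field_simp
    have hWx : W x = S x / (S x ^ 2 * M x ^ 2) := by
      rw [hW]; field_simp
    rw [hkx, hWx]
    exact div_le_div_of_nonneg_right hρS (by positivity)
  have hptw : ∀ x, |f x * k x * P x| ≤ (|f x| * Real.sqrt (W x)) * N x := by
    intro x
    by_cases hx : x ∈ tsupport f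
    · have hPle : |P x| ≤ Real.sqrt (x 0 ^ 2 + x 1 ^ 2) * N x := by
        rw [hP, hN]; exact abs_horiz_pairing_le _ _ _ _
      have hN0 : 0 ≤ N x := by rw [hN]; exact Real.sqrt_nonneg _
      calc |f x * k x * P x| = |f x| * (|k x| * |P x|) := by rw [abs_mul, abs_mul, mul_assoc]
        _ ≤ |f x| * (|k x| * (Real.sqrt (x 0 ^ 2 + x 1 ^ 2) * N x)) :=
          mul_le_mul_of_nonneg_left (mul_le_mul_of_nonneg_left hPle (abs_nonneg _)) (abs_nonneg _)
        _ = |f x| * ((|k x| * Real.sqrt (x 0 ^ 2 + x 1 ^ 2)) * N x) := by ring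
        _ ≤ |f x| * (Real.sqrt (W x) * N x) :=
          mul_le_mul_of_nonneg_left (mul_le_mul_of_nonneg_right (hkW x hx) hN0) (abs_nonneg _)
        _ = (|f x| * Real.sqrt (W x)) * N x := by ring
    · simp [hfK x hx]
  have hWmeas : Measurable W := by
    rw [show W = fun x => (S x * (1 - Real.log (S x) / 2) ^ 2)⁻¹ from
      funext fun x => by rw [hW, hM]]
    exact (hScont.measurable.mul ((measurable_const.sub
      ((Real.measurable_log.comp hScont.measurable).div_const 2)).pow_const 2)).inv
  have cN : Continuous N := by
    rw [show N = fun x => Real.sqrt (fderiv ℝ f x (e 0) ^ 2 + fderiv ℝ f x (e 1) ^ 2) from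
      funext hN]
    exact (((cDf _).pow 2).add ((cDf _).pow 2)).sqrt
  have hNK : HasCompactSupport N := HasCompactSupport.intro hK fun x hx => by
    simp [hN, hDfK x hx]
  have mN : MemLp N 2 (volume : Measure (EuclideanSpace ℝ (Fin 3))) :=
    cN.memLp_of_hasCompactSupport hNK
  have mF : MemLp (fun x => |f x| * Real.sqrt (W x)) 2
      (volume : Measure (EuclideanSpace ℝ (Fin 3))) := by
    have hmeas : AEStronglyMeasurable (fun x => |f x| * Real.sqrt (W x))
        (volume : Measure (EuclideanSpace ℝ (Fin 3))) :=
      ((continuous_abs.measurable.comp cf.measurable).mul hWmeas.sqrt).aestronglyMeasurable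
    refine (memLp_two_iff_integrable_sq hmeas).2 (iX.congr (ae_of_all _ fun x => ?_))
    simp only
    rw [mul_pow, sq_abs, Real.sq_sqrt (hW0 x)]
  have hCS := integral_mul_le_sqrt_mul_sqrt_of_memLp mF mN
  have hF2 : ∫ x, (|f x| * Real.sqrt (W x)) ^ 2 = X := by
    refine integral_congr_ae (ae_of_all _ fun x => ?_)
    simp only
    rw [mul_pow, sq_abs, Real.sq_sqrt (hW0 x)]
  have hN2 : ∫ x, N x ^ 2 = B := by
    refine integral_congr_ae (ae_of_all _ fun x => ?_)
    simp only [hN]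
    rw [Real.sq_sqrt (by positivity)]
  rw [hF2, hN2] at hCS
  have h2 : ∫ x, D x * f x ^ 2 ≤ 2 * (Real.sqrt X * Real.sqrt B) := by
    rw [hstar]
    have hab : |∫ x, f x * k x * P x| ≤ ∫ x, |f x * k x * P x| := abs_integral_le_integral_abs
    have hmono : ∫ x, |f x * k x * P x| ≤ ∫ x, (|f x| * Real.sqrt (W x)) * N x :=
      integral_mono iP.abs (mF.integrable_mul mN) hptw
    have := neg_abs_le (∫ x, f x * k x * P x)
    nlinarith
  -- conclusion `X ≤ 4 B`
  have hXle : X ≤ 2 * (Real.sqrt X * Real.sqrt B) := h1.trans h2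
  have hfinal : X ≤ 4 * B := by
    by_cases hX0' : X = 0
    · rw [hX0']; positivity
    · have hXpos : 0 < X := lt_of_le_of_ne hX0 (Ne.symm hX0')
      have hsX : 0 < Real.sqrt X := Real.sqrt_pos.2 hXpos
      have hsq : Real.sqrt X ≤ 2 * Real.sqrt B := by
        have : Real.sqrt X * Real.sqrt X ≤ (2 * Real.sqrt B) * Real.sqrt X := by
          rw [Real.mul_self_sqrt hX0]; linarith
        exact le_of_mul_le_mul_right this hsX
      calc X = Real.sqrt X ^ 2 := (Real.sq_sqrt hX0).symm
        _ ≤ (2 * Real.sqrt B) ^ 2 := pow_le_pow_left₀ hsX.le hsq 2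
        _ = 4 * B := by rw [mul_pow, Real.sq_sqrt hB0]; norm_num
  have hgoal : ∫ x, f x ^ 2 * ((x 0 ^ 2 + x 1 ^ 2 + δ) *
      (1 - Real.log (x 0 ^ 2 + x 1 ^ 2 + δ) / 2) ^ 2)⁻¹ = X := by
    rw [hX]
    refine integral_congr_ae (ae_of_all _ fun x => ?_)
    simp only [hW, hM, hS]
  have hWfun : (fun x => f x ^ 2 * ((x 0 ^ 2 + x 1 ^ 2 + δ) *
      (1 - Real.log (x 0 ^ 2 + x 1 ^ 2 + δ) / 2) ^ 2)⁻¹) = fun x => f x ^ 2 * W x :=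
    funext fun x => by simp only [hW, hM, hS]
  refine ⟨by rw [hWfun]; exact iX, ?_⟩
  rw [hgoal]
  exact hfinal


/-! ### Lemma 2.2 -/

/-- **Seregin 2022, Lemma 2.2 (Leray's two-dimensional logarithmic Hardy inequality), `ℝ³` form.**
For `f ∈ C¹(ℝ³)` with compact support and `f = 0` wherever `|x'| ≥ 1`
(`cylRadius x = |x'| = √(x₀² + x₁²)`), the function `f²/(|x'|² ln²(e/|x'|))` is integrable on `ℝ³`
and `∫ f²/(|x'|² ln²(e/|x'|)) dx ≤ 4 ∫ ((∂₀f)² + (∂₁f)²) dx = 4 ∫ |∇_{x'} f|² dx`.  On the axis the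
integrand carries the junk value `f²/0 = 0` (a null set).  Limit `δ → 0⁺` of
`integral_sq_mul_regWeight_le` by Fatou's lemma.
[cite: Seregin2022LocalAxisym, §2 Step 3, Lemma 2.2] -/
theorem integral_sq_div_cylRadius_log_sq_le (hf : ContDiff ℝ 1 f) (hfc : HasCompactSupport f)
    (hf1 : ∀ x, 1 ≤ cylRadius x → f x = 0) :
    Integrable (fun x => f x ^ 2 / (cylRadius x ^ 2 * Real.log (Real.exp 1 / cylRadius x) ^ 2)) ∧
    ∫ x, f x ^ 2 / (cylRadius x ^ 2 * Real.log (Real.exp 1 / cylRadius x) ^ 2) ≤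
      4 * ∫ x, (fderiv ℝ f x (EuclideanSpace.single 0 1) ^ 2 +
        fderiv ℝ f x (EuclideanSpace.single 1 1) ^ 2) := by
  set B : ℝ := ∫ x, (fderiv ℝ f x (EuclideanSpace.single 0 1) ^ 2 +
    fderiv ℝ f x (EuclideanSpace.single 1 1) ^ 2) with hB
  obtain ⟨w, hw⟩ : ∃ w : EuclideanSpace ℝ (Fin 3) → ℝ, ∀ x,
      w x = f x ^ 2 / (cylRadius x ^ 2 * Real.log (Real.exp 1 / cylRadius x) ^ 2) :=
    ⟨_, fun x => rfl⟩
  obtain ⟨wn, hwn⟩ : ∃ wn : ℕ → EuclideanSpace ℝ (Fin 3) → ℝ, ∀ n x, wn n x = f x ^ 2 *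
      ((x 0 ^ 2 + x 1 ^ 2 + 1 / ((n : ℝ) + 1)) *
        (1 - Real.log (x 0 ^ 2 + x 1 ^ 2 + 1 / ((n : ℝ) + 1)) / 2) ^ 2)⁻¹ :=
    ⟨_, fun n x => rfl⟩
  have hδpos : ∀ n : ℕ, (0 : ℝ) < 1 / ((n : ℝ) + 1) := fun n => Nat.one_div_pos_of_nat
  have hδle : ∀ n : ℕ, 1 / ((n : ℝ) + 1) ≤ (1 : ℝ) := fun n => by
    have hn : (0 : ℝ) ≤ n := Nat.cast_nonneg n
    rw [div_le_one (by linarith)]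
    linarith
  have cf : Continuous f := hf.continuous
  -- each regularised weight: integrable, integral `≤ 4B`
  have hreg : ∀ n, Integrable (wn n) ∧ ∫ x, wn n x ≤ 4 * B := fun n => by
    rw [show wn n = fun x => _ from funext (hwn n)]
    exact integral_sq_mul_regWeight_le hf hfc hf1 (hδpos n) (hδle n)
  have hwn0 : ∀ n x, 0 ≤ wn n x := fun n x => by
    rw [hwn]
    have := hδpos n
    positivity
  have hwnmeas : ∀ n, Measurable (wn n) := fun n => by
    rw [show wn n = fun x => _ from funext (hwn n)]
    have hSm : Measurable fun x : EuclideanSpace ℝ (Fin 3) =>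
        x 0 ^ 2 + x 1 ^ 2 + 1 / ((n : ℝ) + 1) :=
      (continuous_horizSq_add _).measurable
    exact (cf.measurable.pow_const 2).mul ((hSm.mul ((measurable_const.sub
      ((Real.measurable_log.comp hSm).div_const 2)).pow_const 2)).inv)
  have hw0 : ∀ x, 0 ≤ w x := fun x => by rw [hw]; positivity
  have hwmeas : Measurable w := by
    rw [show w = fun x => _ from funext hw]
    have hc : Measurable cylRadius := continuous_cylRadius.measurable
    exact (cf.measurable.pow_const 2).div ((hc.pow_const 2).mul
      ((Real.measurable_log.comp (measurable_const.div hc)).pow_const 2))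
  -- pointwise: `w ≤ liminf wn` (equality off the axis, `w = 0` on it)
  have hptw : ∀ x, ENNReal.ofReal (w x) ≤ liminf (fun n => ENNReal.ofReal (wn n x)) atTop := by
    intro x
    by_cases hfx : f x = 0
    · simp [hw, hfx]
    · have hr1 : cylRadius x < 1 := lt_of_not_ge fun h => hfx (hf1 x h)
      by_cases hr0 : cylRadius x = 0
      · have : w x = 0 := by rw [hw, hr0]; simp
        rw [this, ENNReal.ofReal_zero]
        exact zero_le
      · have hrpos : 0 < cylRadius x := lt_of_le_of_ne (cylRadius_nonneg x) (Ne.symm hr0)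
        set ρ : ℝ := x 0 ^ 2 + x 1 ^ 2 with hρ
        have hρr : ρ = cylRadius x ^ 2 := (cylRadius_sq x).symm
        have hρpos : 0 < ρ := by rw [hρr]; positivity
        have hρ1 : ρ < 1 := by rw [hρr]; nlinarith [cylRadius_nonneg x]
        have hMρ : 0 < 1 - Real.log ρ / 2 := by
          have : Real.log ρ < 0 := Real.log_neg hρpos hρ1
          linarith
        have hcont : ContinuousAt
            (fun δ : ℝ => ((ρ + δ) * (1 - Real.log (ρ + δ) / 2) ^ 2)⁻¹) 0 := by
          have h1 : ContinuousAt (fun δ : ℝ => ρ + δ) 0 := continuousAt_const.add continuousAt_id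
          have h2 : ContinuousAt (fun δ : ℝ => 1 - Real.log (ρ + δ) / 2) 0 :=
            continuousAt_const.sub ((h1.log (by simpa using hρpos.ne')).div_const 2)
          refine (h1.mul (h2.pow 2)).inv₀ ?_
          simpa using mul_ne_zero hρpos.ne' (pow_ne_zero 2 hMρ.ne')
        have h := (hcont.tendsto.comp tendsto_one_div_add_atTop_nhds_zero_nat).const_mul (f x ^ 2)
        have key : ∀ n : ℕ, f x ^ 2 *
            (((fun δ : ℝ => ((ρ + δ) * (1 - Real.log (ρ + δ) / 2) ^ 2)⁻¹) ∘
            fun n : ℕ => 1 / ((n : ℝ) + 1)) n) = wn n x := fun n => by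
          simp only [Function.comp, hwn, hρ]
        have htend := h.congr key
        have hlim : f x ^ 2 * ((ρ + 0) * (1 - Real.log (ρ + 0) / 2) ^ 2)⁻¹ = w x := by
          rw [add_zero, hw, hρr]
          have hlog : Real.log (Real.exp 1 / cylRadius x) = 1 - Real.log (cylRadius x) := by
            rw [Real.log_div (Real.exp_pos 1).ne' hrpos.ne', Real.log_exp]
          have hlog2 : Real.log (cylRadius x ^ 2) = 2 * Real.log (cylRadius x) := by
            rw [Real.log_pow]; norm_num
          have h3 : (1 : ℝ) - 2 * Real.log (cylRadius x) / 2 = 1 - Real.log (cylRadius x) := by ring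
          rw [hlog, hlog2, h3, div_eq_mul_inv]
        rw [hlim] at htend
        exact ((ENNReal.continuous_ofReal.tendsto _).comp htend).liminf_eq.ge
  -- Fatou
  have hlint : ∫⁻ x, ENNReal.ofReal (w x) ≤ ENNReal.ofReal (4 * B) :=
    calc ∫⁻ x, ENNReal.ofReal (w x)
        ≤ ∫⁻ x, liminf (fun n => ENNReal.ofReal (wn n x)) atTop := lintegral_mono hptw
      _ ≤ liminf (fun n => ∫⁻ x, ENNReal.ofReal (wn n x)) atTop :=
          lintegral_liminf_le fun n => (hwnmeas n).ennreal_ofReal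
      _ ≤ ENNReal.ofReal (4 * B) := by
          refine liminf_le_of_frequently_le' (Frequently.of_forall fun n => ?_)
          rw [← ofReal_integral_eq_lintegral_ofReal (hreg n).1 (ae_of_all _ (hwn0 n))]
          exact ENNReal.ofReal_le_ofReal (hreg n).2
  -- conclusion
  have hB0 : 0 ≤ 4 * B := by
    have : 0 ≤ B := integral_nonneg fun x => by positivity
    linarith
  have hwInt : Integrable w := by
    refine ⟨hwmeas.aestronglyMeasurable, ?_⟩
    rw [hasFiniteIntegral_iff_ofReal (ae_of_all _ hw0)]
    exact hlint.trans_lt ENNReal.ofReal_lt_top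
  have hreal : ∫ x, w x ≤ 4 * B := by
    rw [integral_eq_lintegral_of_nonneg_ae (ae_of_all _ hw0) hwmeas.aestronglyMeasurable]
    exact ENNReal.toReal_le_of_le_ofReal hB0 hlint
  rw [show (fun x => f x ^ 2 / (cylRadius x ^ 2 * Real.log (Real.exp 1 / cylRadius x) ^ 2)) = w
    from funext fun x => (hw x).symm]
  exact ⟨hwInt, hreal⟩


/-- **Seregin 2022, Lemma 2.2, as printed.** "For any function `f ∈ C¹₀(𝒞)`, the following
inequality is valid: `∫_𝒞 |f|²/(|x'|² ln²(e/|x'|)) dx ≤ 4 ∫_𝒞 |∇_{x'} f|² dx`", where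
`𝒞 = {|x'| < 1, |x₃| < 1} = SereginSverak2009.spaceCyl 0 1` and `f ∈ C¹₀(𝒞)` is rendered as
`f ∈ C¹(ℝ³)` with compact support contained in `𝒞`; the left integrand is integrable on `𝒞`.
[cite: Seregin2022LocalAxisym, §2 Step 3, Lemma 2.2] -/
theorem lemma22 (hf : ContDiff ℝ 1 f) (hfc : HasCompactSupport f)
    (hfs : tsupport f ⊆ SereginSverak2009.spaceCyl 0 1) :
    IntegrableOn (fun x => f x ^ 2 / (cylRadius x ^ 2 * Real.log (Real.exp 1 / cylRadius x) ^ 2))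
      (SereginSverak2009.spaceCyl 0 1) ∧
    ∫ x in SereginSverak2009.spaceCyl 0 1,
        f x ^ 2 / (cylRadius x ^ 2 * Real.log (Real.exp 1 / cylRadius x) ^ 2) ≤
      4 * ∫ x in SereginSverak2009.spaceCyl 0 1,
        (fderiv ℝ f x (EuclideanSpace.single 0 1) ^ 2 +
          fderiv ℝ f x (EuclideanSpace.single 1 1) ^ 2) := by
  have hout : ∀ x, x ∉ SereginSverak2009.spaceCyl 0 1 → f x = 0 := fun x hx =>
    image_eq_zero_of_notMem_tsupport fun h => hx (hfs h)
  have hf1 : ∀ x, 1 ≤ cylRadius x → f x = 0 := fun x hx => hout x fun hmem => by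
    rw [SereginSverak2009.mem_spaceCyl, sub_zero] at hmem
    linarith [hmem.1]
  obtain ⟨hint, hle⟩ := integral_sq_div_cylRadius_log_sq_le hf hfc hf1
  have hDout : ∀ x, x ∉ SereginSverak2009.spaceCyl 0 1 → ∀ v, fderiv ℝ f x v = 0 := by
    intro x hx v
    have h0 : fderiv ℝ f x = 0 := by
      by_contra h
      exact hx (hfs (support_fderiv_subset ℝ (Function.mem_support.2 h)))
    rw [h0]; rfl
  refine ⟨hint.integrableOn, ?_⟩
  rw [setIntegral_eq_integral_of_forall_compl_eq_zero fun x hx => by simp [hout x hx],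
    setIntegral_eq_integral_of_forall_compl_eq_zero fun x hx => by simp [hDout x hx]]
  exact hle

/-! ### The transport term vanishes for a locally divergence-free drift -/

/-- **The transport term vanishes, local form** (the integration by parts behind "after
integration by parts, we find …" in Seregin 2022, §2 Step 3, where the drift `v` is smooth and
divergence free only near the support of the cut-off): for `f ∈ C¹(ℝ³)` with compact support and a
drift `b` that is `C¹` with `div b = Σᵢ ∂ᵢbᵢ = 0` on an open set `U ⊇ tsupport f`,
`∫ f · Df[b] = 0` (`2∫ bᵢ f ∂ᵢf = ∫ bᵢ ∂ᵢ(f²) = −∫ (∂ᵢbᵢ) f²`, summed over `i`; Mathlib's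
`integral_mul_fderiv_eq_neg_fderiv_mul_of_integrable` needs `bᵢ` differentiable on `tsupport f²`
only).  Local twin of the tree's whole-space `integral_mul_fderiv_apply_eq_zero_of_isDivFree`
(`AxisymOmegaEnergy.lean`: `b ∈ C¹(ℝ³)` globally divergence free and bounded).
[cite: Seregin2022LocalAxisym, §2 Step 3 (energy identities for η³Φ, η³Γ)] -/
theorem integral_mul_fderiv_apply_eq_zero_of_divFree_near
    {b : EuclideanSpace ℝ (Fin 3) → EuclideanSpace ℝ (Fin 3)}
    {U : Set (EuclideanSpace ℝ (Fin 3))}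
    (hf : ContDiff ℝ 1 f) (hfc : HasCompactSupport f) (hU : IsOpen U) (hfU : tsupport f ⊆ U)
    (hb : ContDiffOn ℝ 1 b U)
    (hdiv : ∀ x ∈ U, ∑ i : Fin 3, fderiv ℝ b x (EuclideanSpace.single i 1) i = 0) :
    ∫ x, f x * fderiv ℝ f x (b x) = 0 := by
  have hsum : ∀ x v : EuclideanSpace ℝ (Fin 3),
      fderiv ℝ f x v = ∑ i : Fin 3, v i * fderiv ℝ f x (EuclideanSpace.single i 1) := by
    intro x v
    conv_lhs => rw [← (EuclideanSpace.basisFun (Fin 3) ℝ).sum_repr v]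
    rw [map_sum]
    refine Finset.sum_congr rfl fun i _ => ?_
    rw [map_smul, smul_eq_mul, EuclideanSpace.basisFun_repr, EuclideanSpace.basisFun_apply]
  set e : Fin 3 → EuclideanSpace ℝ (Fin 3) := fun i => EuclideanSpace.single i 1 with he
  have he' : ∀ i, EuclideanSpace.single i (1 : ℝ) = e i := fun i => rfl
  have hfd : Differentiable ℝ f := hf.differentiable one_ne_zero
  have cf : Continuous f := hf.continuous
  have cDf : ∀ v, Continuous fun x => fderiv ℝ f x v := fun v =>
    (hf.continuous_fderiv one_ne_zero).clm_apply continuous_const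
  have hfK : ∀ x, x ∉ tsupport f → f x = 0 := fun x hx => image_eq_zero_of_notMem_tsupport hx
  have cb : ContinuousOn b U := hb.continuousOn
  have cDb : ContinuousOn (fun x => fderiv ℝ b x) U := hb.continuousOn_fderiv_of_isOpen hU le_rfl
  have hbd : ∀ x ∈ U, DifferentiableAt ℝ b x := fun x hx =>
    (hb.differentiableOn one_ne_zero x hx).differentiableAt (hU.mem_nhds hx)
  have cx : ∀ i : Fin 3, Continuous fun x : EuclideanSpace ℝ (Fin 3) => x i := fun i =>
    (contDiff_piLp_apply (𝕜 := ℝ) (p := 2) (n := 0) (i := i)).continuous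
  -- coordinates of `b` and of `Db`
  have hbi : ∀ i : Fin 3, ∀ x ∈ U, DifferentiableAt ℝ (fun y => b y i) x := fun i x hx =>
    (EuclideanSpace.proj (𝕜 := ℝ) i).differentiableAt.comp x (hbd x hx)
  have hDbi : ∀ i : Fin 3, ∀ x ∈ U, ∀ v,
      fderiv ℝ (fun y => b y i) x v = fderiv ℝ b x v i := by
    intro i x hx v
    have h := ((EuclideanSpace.proj (𝕜 := ℝ) i : EuclideanSpace ℝ (Fin 3) →L[ℝ] ℝ).hasFDerivAt.comp
      x (hbd x hx).hasFDerivAt)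
    rw [show (fun y => b y i) =
        (EuclideanSpace.proj (𝕜 := ℝ) i : EuclideanSpace ℝ (Fin 3) →L[ℝ] ℝ) ∘ b from rfl,
      h.fderiv]
    rfl
  -- integrability helper
  have hInt : ∀ {F : EuclideanSpace ℝ (Fin 3) → ℝ},
      (∀ x ∈ tsupport f, ContinuousWithinAt F (tsupport f) x) →
      (∀ x, x ∉ tsupport f → F x = 0) → Integrable F := fun hF h0 =>
    integrable_of_continuousOn_tsupport hfc hF (support_subset_iff'.2 h0)
  have cbK : ∀ i : Fin 3, ContinuousOn (fun x => b x i) (tsupport f) := fun i =>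
    ((cx i).comp_continuousOn cb).mono hfU
  have cDbK : ∀ i : Fin 3, ContinuousOn (fun x => fderiv ℝ b x (e i) i) (tsupport f) := fun i =>
    ((cx i).comp_continuousOn ((cDb.clm_apply continuousOn_const))).mono hfU
  -- by parts in the direction `e i`: `2 ∫ bᵢ f ∂ᵢf = -∫ (∂ᵢbᵢ) f²`
  have hDg : ∀ x v, fderiv ℝ (fun y => f y ^ 2) x v = 2 * f x * fderiv ℝ f x v :=
    fderiv_sq_apply hfd
  have hgd : Differentiable ℝ fun y => f y ^ 2 := hfd.pow 2
  have ibp : ∀ i : Fin 3, ∫ x, (b x i) * (2 * f x * fderiv ℝ f x (e i)) =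
      -∫ x, fderiv ℝ b x (e i) i * f x ^ 2 := by
    intro i
    have i1 : Integrable fun x => fderiv ℝ (fun y => b y i) x (e i) * f x ^ 2 := by
      have i1' : Integrable fun x => fderiv ℝ b x (e i) i * f x ^ 2 :=
        hInt (fun x hx => ((cDbK i).mul ((cf.pow 2).continuousOn)) x hx)
          (fun x hx => by simp [hfK x hx])
      refine i1'.congr (ae_of_all _ fun x => ?_)
      beta_reduce
      by_cases hx : x ∈ tsupport f
      · rw [hDbi i x (hfU hx)]
      · simp [hfK x hx]
    have i2 : Integrable fun x => (b x i) * fderiv ℝ (fun y => f y ^ 2) x (e i) := by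
      have i2' : Integrable fun x => (b x i) * (2 * f x * fderiv ℝ f x (e i)) :=
        hInt (fun x hx => ((cbK i).mul (((continuous_const.mul cf).mul (cDf _)).continuousOn)) x hx)
          (fun x hx => by simp [hfK x hx])
      exact i2'.congr (ae_of_all _ fun x => by beta_reduce; rw [hDg])
    have i3 : Integrable fun x => (b x i) * f x ^ 2 :=
      hInt (fun x hx => ((cbK i).mul ((cf.pow 2).continuousOn)) x hx)
        (fun x hx => by simp [hfK x hx])
    have hsub : tsupport (fun y => f y ^ 2) ⊆ tsupport f := by
      refine closure_mono fun y hy => ?_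
      rw [Function.mem_support] at hy ⊢
      exact fun h => hy (by simp [h])
    have h := integral_mul_fderiv_eq_neg_fderiv_mul_of_integrable (μ := volume)
      (f := fun y => b y i) (g := fun y => f y ^ 2) (v := e i) i1 i2 i3
      (fun x hx => hbi i x (hfU (hsub hx))) (fun x _ => hgd x)
    rw [show (fun x => (b x i) * (2 * f x * fderiv ℝ f x (e i))) =
        fun x => (b x i) * fderiv ℝ (fun y => f y ^ 2) x (e i) from funext fun x => by rw [hDg]]
    rw [h]
    congr 1
    refine integral_congr_ae (ae_of_all _ fun x => ?_)
    beta_reduce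
    by_cases hx : x ∈ tsupport f
    · rw [hDbi i x (hfU hx)]
    · simp [hfK x hx]
  -- sum over `i`
  have iL : ∀ i : Fin 3, Integrable fun x => (b x i) * (2 * f x * fderiv ℝ f x (e i)) := fun i =>
    hInt (fun x hx => ((cbK i).mul (((continuous_const.mul cf).mul (cDf _)).continuousOn)) x hx)
      (fun x hx => by simp [hfK x hx])
  have iR : ∀ i : Fin 3, Integrable fun x => fderiv ℝ b x (e i) i * f x ^ 2 := fun i =>
    hInt (fun x hx => ((cDbK i).mul ((cf.pow 2).continuousOn)) x hx)
      (fun x hx => by simp [hfK x hx])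
  have hL : ∫ x, 2 * (f x * fderiv ℝ f x (b x)) =
      ∑ i : Fin 3, ∫ x, (b x i) * (2 * f x * fderiv ℝ f x (e i)) := by
    rw [← integral_finsetSum _ fun i _ => iL i]
    refine integral_congr_ae (ae_of_all _ fun x => ?_)
    beta_reduce
    rw [hsum x (b x), Finset.mul_sum, Finset.mul_sum]
    refine Finset.sum_congr rfl fun i _ => ?_
    simp only [he']
    ring
  have hR : ∑ i : Fin 3, ∫ x, fderiv ℝ b x (e i) i * f x ^ 2 = 0 := by
    rw [← integral_finsetSum _ fun i _ => iR i]
    refine integral_eq_zero_of_ae (ae_of_all _ fun x => ?_)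
    show ∑ i : Fin 3, fderiv ℝ b x (e i) i * f x ^ 2 = 0
    by_cases hx : x ∈ tsupport f
    · rw [← Finset.sum_mul]
      simp only [he'] at hdiv
      rw [hdiv x (hfU hx), zero_mul]
    · simp [hfK x hx]
  have h2 : ∫ x, 2 * (f x * fderiv ℝ f x (b x)) = 0 := by
    rw [hL]
    calc ∑ i : Fin 3, ∫ x, (b x i) * (2 * f x * fderiv ℝ f x (e i))
        = ∑ i : Fin 3, (-∫ x, fderiv ℝ b x (e i) i * f x ^ 2) :=
          Finset.sum_congr rfl fun i _ => ibp i
      _ = -∑ i : Fin 3, ∫ x, fderiv ℝ b x (e i) i * f x ^ 2 := by rw [Finset.sum_neg_distrib]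
      _ = 0 := by rw [hR, neg_zero]
  rw [integral_const_mul] at h2
  linarith

end Seregin2022

end Literature.Analysis.FluidPDE
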